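import Literature.NumberTheory.GaloisRepresentations.AlgebraicHeckeCharacterPurity
import Literature.NumberTheory.GaloisRepresentations.WeakAbelianDirectSummandCyclotomicProofs
import HarnessLib

/-!
# Line `Sketch` for the crux `ReciprocityUpToIrreducibility` (item stmt-Langlands-14328), wave N11-B:
# a parallel infinity type is killed by a norm twist

Support file (closes nothing; stub `stub_normTwist_hasInfinityType_zero_of_parallel` of the registered
skeleton of line `Sketch`, continuation lead c9).

Let `χ` be an idelic Hecke character of the number field `K` (tree `HeckeCharacter`) of infinity
type `(p, q)` (`HeckeCharacter.HasInfinityType`: near `1` in `(K ⊗ ℝ)ˣ`,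
`χ((x, 1)) = A_{p,q}(x) = ∏_w ι_w(x_w)^{-p_w} \overline{ι_w(x_w)}^{-q_w}`), and assume the type is
PARALLEL: `p_w = q_w` at every complex place `w`.  Then `χ · ‖·‖^k` has infinity type `(0, 0)` for
some `k ∈ ℤ` (so it has finite order, wave N11-A).  Proof, all from proved tree theorems:

* purity (`HasInfinityType.exists_two_mul_add_eq_weight_mul_mult`, Weil 1956 / Patrikis 2019
  Lemma 2.1.3): `2 (p_w + q_w) = wt · [K_w : ℝ]` for one integer `wt`; reading it at any infinite
  place (and using `p_w = q_w` if that place is complex) shows `wt = 2k` is even, whence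
  `p_w + q_w = k` at real places and `p_w = q_w = k` at complex places;
* `hasInfinityType_normCharacter` — **the norm character `‖·‖` has infinity type `(-1; 0 / -1)`**
  (`p_w = -1` everywhere, `q_w = 0` at real and `-1` at complex `w`): on the neighbourhood of `1`
  where the real coordinates are positive, `‖(x,1)‖ = ∏_w ‖x_w‖^{[K_w:ℝ]} = ∏_{w real} ι_w(x_w) ·
  ∏_{w complex} ι_w(x_w) \overline{ι_w(x_w)}` (the computation inside the tree's
  `HeckeCharacter.isAlgebraic_normCharacter`, here with the exponents recorded);
* infinity types multiply and take integer powers exponent-wise (`hasInfinityType_mul`,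
  `hasInfinityType_zpow`), so `χ ‖·‖^k` has type `(p - k; q at real / q - k at complex)`, which is
  `(0, 0)` at complex places and has `p_w - k + q_w = 0` at real places;
* at a real place only the SUM `p_w + q_w` of the exponents matters, because `ι_w(x_w)` is real
  there (`hasInfinityType_congr_of_isReal`), so the type is `(0, 0)`.

References: A. Weil, *On a certain type of characters of the idèle-class group of an algebraic
number-field* (1956), §1 [Weil1956]; J.-P. Serre, *Abelian ℓ-adic representations and elliptic
curves* (1968), Ch. II §2.3–2.4 [SerreAbelianLadic1968]; S. Patrikis, *Variations on a theorem of
Tate* (2019), Lemma 2.1.3 [Patrikis2019]; J. Neukirch, *Algebraic Number Theory* (1999), Ch. VII §6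
Prop. (6.9) [NeukirchANT1999].
-/

noncomputable section

set_option linter.dupNamespace false -- project-wide option (lakefile weak.linter.dupNamespace); `Summit.Langlands.Langlands` is the mandated namespace

open scoped NumberField Classical ComplexConjugate
open Filter IsDedekindDomain NumberField NumberField.InfinitePlace NumberField.InfinitePlace.Completion
open Literature.NumberTheory.GaloisRepresentations

namespace Summit.Langlands.Langlands.Theorems.ReciprocityUpToIrreducibility

variable {K : Type} [Field K] [NumberField K]

/-! ### Infinity types: products, integer powers, real places -/

/-- **The infinity type of a product is the sum of the infinity types**: if `χ` has type `(p, q)`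
and `ψ` has type `(p', q')` then `χψ` has type `(p + p', q + q')` (on the intersection of the two
neighbourhoods of `1`, `A_{p,q} A_{p',q'} = A_{p+p',q+q'}`).  Weil 1956, §1 (the characters of type
`A₀` form a group). [cite: Weil1956, §1] -/
theorem hasInfinityType_mul {χ ψ : HeckeCharacter K} {p q p' q' : InfinitePlace K → ℤ}
    (hχ : χ.HasInfinityType p q) (hψ : ψ.HasInfinityType p' q') :
    (χ * ψ).HasInfinityType (p + p') (q + q') := by
  -- adapted from `HasInfinityType.mul'`
  --   (Summits/Langlands/Langlands/Theorems/PicardMuOrdinaryResidualAutomorphyEvenHeckeAlgebra.lean)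
  obtain ⟨U, hU, hχU⟩ := hχ
  obtain ⟨V, hV, hψV⟩ := hψ
  refine ⟨U ∩ V, inter_mem hU hV, fun x hx => ?_⟩
  rw [HeckeCharacter.mul_apply, Units.val_mul, hχU x hx.1, hψV x hx.2,
    HeckeCharacter.archFactor_apply, HeckeCharacter.archFactor_apply,
    HeckeCharacter.archFactor_apply, ← Finset.prod_mul_distrib]
  refine Finset.prod_congr rfl fun w _ => ?_
  have hz : extensionEmbedding w ((x : InfiniteAdeleRing K) w) ≠ 0 :=
    InfiniteIdele.extensionEmbedding_apply_ne_zero x w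
  have hz' : conj (extensionEmbedding w ((x : InfiniteAdeleRing K) w)) ≠ 0 :=
    (map_ne_zero (starRingEnd ℂ)).mpr hz
  simp only [Pi.add_apply, neg_add, zpow_add₀ hz, zpow_add₀ hz']
  ring

/-- `(χ^k)(x) = χ(x)^k` for `k ∈ ℤ` (integer powers of Hecke characters are pointwise). [folklore] -/
private theorem zpow_apply_aux (χ : HeckeCharacter K) (k : ℤ) (x : ideleGroup K) :
    (χ ^ k) x = χ x ^ k := by
  obtain ⟨n, rfl | rfl⟩ := k.eq_nat_or_neg
  · rw [zpow_natCast, zpow_natCast, HeckeCharacter.pow_apply]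
  · rw [zpow_neg, zpow_neg, zpow_natCast, zpow_natCast, HeckeCharacter.inv_apply,
      HeckeCharacter.pow_apply]

/-- **Integer powers act on the infinity type exponent-wise**: if `χ` has type `(p, q)` then `χ^k`
has type `(k p, k q)` for every `k ∈ ℤ` (`A_{p,q}^k = A_{kp,kq}` on the same neighbourhood of `1`).
Weil 1956, §1. [cite: Weil1956, §1] -/
theorem hasInfinityType_zpow {χ : HeckeCharacter K} {p q : InfinitePlace K → ℤ}
    (h : χ.HasInfinityType p q) (k : ℤ) :
    (χ ^ k).HasInfinityType (fun w => k * p w) (fun w => k * q w) := by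
  obtain ⟨U, hU, hχU⟩ := h
  refine ⟨U, hU, fun x hx => ?_⟩
  rw [zpow_apply_aux, Units.val_zpow_eq_zpow_val, hχU x hx, HeckeCharacter.archFactor_apply,
    HeckeCharacter.archFactor_apply, ← Finset.prod_zpow]
  refine Finset.prod_congr rfl fun w _ => ?_
  rw [mul_zpow, ← zpow_mul, ← zpow_mul, show -p w * k = -(k * p w) by ring,
    show -q w * k = -(k * q w) by ring]

/-- **At a real place only the sum `p_w + q_w` of the exponents matters.**  If `χ` has infinity
type `(p, q)`, and `(p', q')` has the same sum `p'_w + q'_w = p_w + q_w` at every real place and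
agrees with `(p, q)` at every complex place, then `χ` also has infinity type `(p', q')`: at a real
place `w` the coordinate `ι_w(x_w)` is real, so `ι_w(x_w)^{-p_w} \overline{ι_w(x_w)}^{-q_w} =
ι_w(x_w)^{-(p_w + q_w)}`.  (Weil 1956, §1: at a real place the type is the single integer
`n_φ = p_w + q_w`, the tree's `HeckeCharacter.embExponent`.) [cite: Weil1956, §1] -/
theorem hasInfinityType_congr_of_isReal {χ : HeckeCharacter K} {p q p' q' : InfinitePlace K → ℤ}
    (h : χ.HasInfinityType p q) (hre : ∀ w : InfinitePlace K, w.IsReal → p w + q w = p' w + q' w)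
    (hp : ∀ w : InfinitePlace K, w.IsComplex → p w = p' w)
    (hq : ∀ w : InfinitePlace K, w.IsComplex → q w = q' w) :
    χ.HasInfinityType p' q' := by
  obtain ⟨U, hU, hχU⟩ := h
  refine ⟨U, hU, fun x hx => ?_⟩
  rw [hχU x hx, HeckeCharacter.archFactor_apply, HeckeCharacter.archFactor_apply]
  refine Finset.prod_congr rfl fun w _ => ?_
  rcases w.isReal_or_isComplex with hw | hw
  · -- real place: `ι_w(x_w)` is real, so only `p_w + q_w` matters
    have hz : extensionEmbedding w ((x : InfiniteAdeleRing K) w) ≠ 0 :=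
      InfiniteIdele.extensionEmbedding_apply_ne_zero x w
    have hreal : conj (extensionEmbedding w ((x : InfiniteAdeleRing K) w)) =
        extensionEmbedding w ((x : InfiniteAdeleRing K) w) := by
      rw [← extensionEmbeddingOfIsReal_apply hw, Complex.conj_ofReal]
    rw [hreal, ← zpow_add₀ hz, ← zpow_add₀ hz, ← neg_add, ← neg_add, hre w hw]
  · -- complex place: the exponents agree
    rw [hp w hw, hq w hw]

/-! ### The infinity type of the norm character -/

variable (K) in
/-- **The norm character has infinity type `(-1; 0 / -1)`**: `‖·‖ = HeckeCharacter.normCharacter K`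
has infinity type `(p, q)` with `p_w = -1` at every infinite place `w`, `q_w = 0` at real and
`q_w = -1` at complex `w`.  Indeed, for every infinite idele `x` whose real coordinates are positive
(an open neighbourhood of `1`),
`‖(x, 1)‖ = ∏_w ‖x_w‖^{[K_w:ℝ]} = ∏_{w real} ι_w(x_w) · ∏_{w complex} ι_w(x_w) \overline{ι_w(x_w)}`
(`ι_w = extensionEmbedding w` is an isometry, real-valued at real `w`).  Weil 1956 (`‖·‖` is of type
`A₀`); Serre 1968, Ch. II §2.3 (the character attached to the norm).
[cite: SerreAbelianLadic1968, Ch. II §2.3] -/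
theorem hasInfinityType_normCharacter :
    (HeckeCharacter.normCharacter K).HasInfinityType (fun _ => -1)
      (fun w => if w.IsReal then 0 else -1) := by
  -- adapted from `HeckeCharacter.isAlgebraic_normCharacter`
  --   (Literature/NumberTheory/GaloisRepresentations/WeakAbelianDirectSummandCyclotomicProofs.lean),
  --   which proves exactly this inside the existential `IsAlgebraic = ∃ p q, HasInfinityType p q`.
  -- notation: the complex coordinate of `x` at `w`
  set E : InfinitePlace K → (InfiniteAdeleRing K)ˣ → ℂ := fun w x =>
    extensionEmbedding w ((x : InfiniteAdeleRing K) w) with hE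
  have hEcont : ∀ w, Continuous (E w) := fun w =>
    (isometry_extensionEmbedding w).continuous.comp ((continuous_apply w).comp Units.continuous_val)
  have hEnorm : ∀ w x, ‖E w x‖ = ‖(x : InfiniteAdeleRing K) w‖ := fun w x =>
    (isometry_extensionEmbedding w).norm_map_of_map_zero (map_zero _) _
  -- the neighbourhood: positive real coordinates
  set U : Set (InfiniteAdeleRing K)ˣ := {x | ∀ w : InfinitePlace K, w.IsReal → 0 < (E w x).re}
    with hU
  have hUopen : IsOpen U := by
    have : U = ⋂ w : InfinitePlace K, {x | w.IsReal → 0 < (E w x).re} := by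
      ext x; simp [hU]
    rw [this]
    refine isOpen_iInter_of_finite fun w => ?_
    by_cases hw : w.IsReal
    · have : {x : (InfiniteAdeleRing K)ˣ | w.IsReal → 0 < (E w x).re} =
          (fun x => (E w x).re) ⁻¹' Set.Ioi 0 := by
        ext x; simp [hw]
      rw [this]
      exact isOpen_Ioi.preimage (Complex.continuous_re.comp (hEcont w))
    · have : {x : (InfiniteAdeleRing K)ˣ | w.IsReal → 0 < (E w x).re} = Set.univ := by
        ext x; simp [hw]
      rw [this]
      exact isOpen_univ
  have hUone : (1 : (InfiniteAdeleRing K)ˣ) ∈ U := fun w _ => by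
    simp only [hE, Units.val_one]
    rw [show (1 : InfiniteAdeleRing K) w = 1 from rfl, map_one, Complex.one_re]
    exact one_pos
  refine ⟨U, hUopen.mem_nhds hUone, fun x hx => ?_⟩
  rw [HeckeCharacter.normCharacter_apply, HeckeCharacter.ideleNorm_infiniteIdeles,
    Complex.ofReal_prod, HeckeCharacter.archFactor_apply]
  refine Finset.prod_congr rfl fun w _ => ?_
  change ((‖(x : InfiniteAdeleRing K) w‖ ^ w.mult : ℝ) : ℂ) =
    E w x ^ (-(-1 : ℤ)) * conj (E w x) ^ (-(if w.IsReal then (0 : ℤ) else -1))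
  rw [Complex.ofReal_pow, ← hEnorm w x, neg_neg, zpow_one]
  by_cases hw : w.IsReal
  · -- real place: `E w x` is a positive real number
    rw [mult, if_pos hw, if_pos hw, neg_zero, zpow_zero, mul_one, pow_one]
    have hreal : ((extensionEmbeddingOfIsReal hw ((x : InfiniteAdeleRing K) w) : ℝ) : ℂ) = E w x :=
      extensionEmbeddingOfIsReal_apply hw _
    have hpos : 0 < (E w x).re := hx w hw
    rw [← hreal] at hpos ⊢
    rw [Complex.ofReal_re] at hpos
    rw [Complex.norm_real, Real.norm_eq_abs, abs_of_pos hpos]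
  · -- complex place: `|z|² = z \bar z`
    rw [mult, if_neg hw, if_neg hw, neg_neg, zpow_one, Complex.mul_conj']

/-! ### The stub -/

/-- **stub N11-B (Weil 1956 §1; folklore): a PARALLEL infinity type is a norm power up to type
`(0, 0)`.**  If `χ` has infinity type `(p, q)` with `p_w = q_w` at every complex place `w`, then
for some `k ∈ ℤ` the character `χ · ‖·‖^k` has infinity type `(0, 0)`: purity
(`HasInfinityType.exists_two_mul_add_eq_weight_mul_mult`: `2 (p_w + q_w) = wt [K_w : ℝ]`) makes
`wt = 2k` even and `p_w + q_w = k` at real, `p_w = q_w = k` at complex places; `‖·‖` has infinity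
type `(-1; 0 at real / -1 at complex)` (`hasInfinityType_normCharacter`), types add under products
and scale under integer powers (`hasInfinityType_mul`, `hasInfinityType_zpow`), and at a real place
only `p_w + q_w` matters (`hasInfinityType_congr_of_isReal`).
[cite: Weil1956, §1] [cite: NeukirchANT1999, Ch. VII §6 Prop. (6.9)] -/
theorem stub_normTwist_hasInfinityType_zero_of_parallel :
    ∀ (K : Type) [Field K] [NumberField K] (χ : HeckeCharacter K) (p q : NumberField.InfinitePlace K → ℤ),
      χ.HasInfinityType p q → (∀ w : NumberField.InfinitePlace K, w.IsComplex → p w = q w) →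
      ∃ k : ℤ, (χ * HeckeCharacter.normCharacter K ^ k).HasInfinityType 0 0 := by
  intro K _ _ χ p q hχ hpar
  -- purity: `2 (p_w + q_w) = wt [K_w : ℝ]`
  obtain ⟨wt, hwt⟩ := hχ.exists_two_mul_add_eq_weight_mul_mult
  -- the weight is even, `wt = 2 k`: read purity at any infinite place
  obtain ⟨k, rfl⟩ : ∃ k : ℤ, wt = 2 * k := by
    obtain ⟨w₀⟩ : Nonempty (InfinitePlace K) := inferInstance
    have h0 := hwt w₀
    rcases w₀.isReal_or_isComplex with hw | hw
    · rw [mult, if_pos hw, Nat.cast_one, mul_one] at h0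
      exact ⟨p w₀ + q w₀, h0.symm⟩
    · rw [mult, if_neg (not_isReal_iff_isComplex.mpr hw), Nat.cast_ofNat, hpar w₀ hw] at h0
      exact ⟨q w₀, by linarith⟩
  -- hence `p_w + q_w = k` at real places and `p_w = q_w = k` at complex places
  have hre : ∀ w : InfinitePlace K, w.IsReal → p w + q w = k := fun w hw => by
    have h0 := hwt w
    rw [mult, if_pos hw, Nat.cast_one, mul_one] at h0
    linarith
  have hcx : ∀ w : InfinitePlace K, w.IsComplex → p w = k ∧ q w = k := fun w hw => by
    have h0 := hwt w
    rw [mult, if_neg (not_isReal_iff_isComplex.mpr hw), Nat.cast_ofNat] at h0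
    have h1 := hpar w hw
    constructor <;> linarith
  -- `χ ‖·‖^k` has type `(p - k; q / q - k)`, congruent to `(0, 0)`
  refine ⟨k, hasInfinityType_congr_of_isReal
    (hasInfinityType_mul hχ (hasInfinityType_zpow (hasInfinityType_normCharacter K) k))
    (fun w hw => ?_) (fun w hw => ?_) (fun w hw => ?_)⟩
  · simp only [Pi.add_apply, Pi.zero_apply, if_pos hw]
    linarith [hre w hw]
  · simp only [Pi.add_apply, Pi.zero_apply]
    linarith [(hcx w hw).1]
  · simp only [Pi.add_apply, Pi.zero_apply, if_neg (not_isReal_iff_isComplex.mpr hw)]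
    linarith [(hcx w hw).2]

end Summit.Langlands.Langlands.Theorems.ReciprocityUpToIrreducibility

end
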